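import Mathlib
import Summits.ValiantsHypothesis.ValiantsHypothesis.Theorems.BarrierLeverSuccinctHittingSetsForVPSeparableCoeffThree
import Summits.ValiantsHypothesis.ValiantsHypothesis.Theorems.BarrierLeverSuccinctHittingSetsForVPGenerator
import HarnessLib

/-!
# Products of sparse distinguishers are hit by `SmallCircuits ℂ n 5` (crux stmt-ValiantsHypothesis-14610
side; docket 8745/8749 of seat val-np-p5)

**What is proved (unconditional; it does NOT close any item).** The tree's `exists_sparseGenerator` /
`isSuccinctHittingSet_sparseProducts` / `not_isNaturalProof_prod_sparse` (FSV Cor. 34 in regime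
`d = n`, multiplicative form: every nonzero finite product of `N^a`-sparse polynomials in the
`N = C(2n,n)` coefficient variables — e.g. every `ΠΣ` / `ΠΣΠ` distinguisher with `poly(N)`-sparse
product gates — is hit) live at exponent `10`, the cost of realising the `2an` seed polynomials of the
shifted succinct Shpilka–Volkovich generator by `stub_separableCoeff` (exponent `8`). With
`SeparableCoeffThree.separableCoeff_three` (exponent `3`) the SAME generator takes its values in
`coeff(SmallCircuits ℂ n 5)` for `n ≥ max 6 (2a + 2)` (`SparseProductsFive.size_budget_five`:
`n³ + (2an(n³+1) + 2an) + 1 ≤ n⁵`), so the three theorems hold with `10 ↦ 5`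
(`exists_sparseGenerator_five`, `isSuccinctHittingSet_sparseProducts_five`,
`not_isNaturalProof_prod_sparse_five`). The non-annihilation half is the tree's, verbatim
(`Sparse.exists_narrow_monomial_shift`, `LowSupport.exists_eval_ne_zero_supported`, `stub_svHit`).

Honest framing: 14610-side bookkeeping (chart row 'products of sparse / ΠΣΠ with sparse product
gates': 10 → 5; single sparse distinguishers are already at the open rung `b = 2` by
`SparsityWall.isSuccinctHittingSet_sparse_two`); nothing here bears on `VP ≠ VNP`.

References: [ForbesShpilkaVolk2018] Construction 29, Cor. 34; [ShpilkaVolkovich2015] Thm. 1.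
-/

-- layout Summits/ValiantsHypothesis/ValiantsHypothesis forces the duplicated namespace component
set_option linter.dupNamespace false

noncomputable section

namespace Summit.ValiantsHypothesis.ValiantsHypothesis.Theorems.BarrierLever.SuccinctHittingSetsForVP

open Literature.Barriers.ValiantsHypothesis Literature.Computability.AlgebraicComplexity MvPolynomial

namespace SparseProductsFive

/-- The size budget with exponent-3 pieces: for `n ≥ 2a + 2` and `n ≥ 2`,
`n³ + (2an(n³ + 1) + 2an) + 1 ≤ n⁵`. [folklore] -/
theorem size_budget_five {a n : ℕ} (ha : 2 * a + 2 ≤ n) (hn : 2 ≤ n) :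
    n ^ 3 + (2 * a * n * (n ^ 3 + 1) + 2 * a * n) + 1 ≤ n ^ 5 := by
  have h1 : 2 * a * n * (n ^ 3 + 1) + 2 * a * n = 2 * a * n ^ 4 + 4 * a * n := by ring
  have h2 : 4 * a * n ≤ 2 * n * n := by nlinarith
  have h3 : n ^ 3 + 2 * n * n + 1 ≤ 2 * n ^ 4 := by
    obtain ⟨m, rfl⟩ : ∃ m, n = m + 2 := ⟨n - 2, by omega⟩
    ring_nf
    nlinarith [Nat.zero_le m, Nat.zero_le (m * m), Nat.zero_le (m * m * m), Nat.zero_le (m ^ 4),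
      Nat.zero_le (m ^ 3)]
  calc n ^ 3 + (2 * a * n * (n ^ 3 + 1) + 2 * a * n) + 1
      = 2 * a * n ^ 4 + (n ^ 3 + 4 * a * n + 1) := by rw [h1]; ring
    _ ≤ 2 * a * n ^ 4 + 2 * n ^ 4 := by omega
    _ = (2 * a + 2) * n ^ 4 := by ring
    _ ≤ n * n ^ 4 := Nat.mul_le_mul_right _ ha
    _ = n ^ 5 := by ring

end SparseProductsFive

open Generator

/-- **The shifted succinct SV generator at exponent 5.** For every `a` there is `n₀` (`= max 6 (2a+2)`)
such that for all `n ≥ n₀` the generator `Γ_μ = coeff_μ f₀ + Σ_{j < 2an} W_j ∏_i ℓ_{μ_i}(Z_{j,i})`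
takes ALL its values in `coeff(SmallCircuits ℂ n 5)` and is annihilated by NO nonzero polynomial with
at most `C(2n,n)^a` monomials (tree: `exists_sparseGenerator`, exponent `10`).
[cite: ForbesShpilkaVolk2018, Construction 29 and Cor. 34] -/
theorem exists_sparseGenerator_five :
    ∀ a : ℕ, ∃ n₀ : ℕ, ∀ n : ℕ, n₀ ≤ n →
      ∃ (t : ℕ) (Γ : degLEMonomials n → MvPolynomial (Fin t ⊕ (Fin t × Fin n)) ℂ),
        (∀ p : Fin t ⊕ (Fin t × Fin n) → ℂ, ∃ f ∈ SmallCircuits ℂ n 5,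
            ∀ μ : degLEMonomials n,
              MvPolynomial.coeff (μ : Fin n →₀ ℕ) f = MvPolynomial.eval p (Γ μ)) ∧
        ∀ D : MvPolynomial (degLEMonomials n) ℂ, D ≠ 0 →
          D.support.card ≤ Nat.choose (2 * n) n ^ a → MvPolynomial.aeval Γ D ≠ 0 := by
  -- adapted from the tree's `stub_generatorGlue` (exponent 10), pieces at exponent 3
  intro a
  refine ⟨max 6 (2 * a + 2), fun n hn => ?_⟩
  have hn6 : 6 ≤ n := le_of_max_le_left hn
  have hna : 2 * a + 2 ≤ n := le_of_max_le_right hn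
  obtain ⟨ℓ, hℓ⟩ := stub_lagrangeIndicator n
  obtain ⟨f₀, hf₀, hfull⟩ := stub_fullSupport n (by omega)
  refine ⟨2 * a * n, fun μ => C (coeff (μ : Fin n →₀ ℕ) f₀) +
      ∑ j : Fin (2 * a * n), X (Sum.inl j) * rename (fun z => Sum.inr (j, z))
        (∏ i : Fin n, Polynomial.aeval (X i : MvPolynomial (Fin n) ℂ) (ℓ ((μ : Fin n →₀ ℕ) i))),
    fun p => ?_, fun D hD0 hDa => ?_⟩
  · choose Λ hΛmem hΛcoeff using fun j : Fin (2 * a * n) =>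
      SeparableCoeffThree.separableCoeff_three n hn6 (fun i k => (ℓ k).eval (p (Sum.inr (j, i))))
    refine ⟨f₀ + ∑ j : Fin (2 * a * n), C (p (Sum.inl j)) * Λ j,
      GeneratorGlue.add_sum_mem_smallCircuits (SparseProductsFive.size_budget_five hna (by omega))
        hf₀ hΛmem _,
      fun μ => ?_⟩
    rw [GeneratorGlue.coeff_add_sum, GeneratorGlue.eval_generator]
    simp only [GeneratorGlue.eval_prod_aeval, hΛcoeff]
  · obtain ⟨m, hm, hmcard⟩ := Sparse.exists_narrow_monomial_shift hfull hD0
    have hcard : m.support.card ≤ 2 * a * n := GeneratorGlue.card_le_of_two_pow_le hmcard hDa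
    obtain ⟨w, hw, hne⟩ := LowSupport.exists_eval_ne_zero_supported hm
    rw [ShiftedSupport.eval_shift] at hne
    exact stub_svHit (degLEMonomials n) (Fin n) (2 * a * n)
      (fun μ => ∏ i : Fin n, Polynomial.aeval (X i : MvPolynomial (Fin n) ℂ) (ℓ ((μ : Fin n →₀ ℕ) i)))
      (fun ν i => (((ν : Fin n →₀ ℕ) i : ℕ) : ℂ)) (GeneratorGlue.eval_indicator hℓ)
      (fun μ => coeff (μ : Fin n →₀ ℕ) f₀) D ⟨m.support, w, hcard, hw, hne⟩

/-- **Products of sparse polynomials are hit by `SmallCircuits ℂ n 5`** (tree: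
`isSuccinctHittingSet_sparseProducts`, exponent `10`): for every `a`, eventually in `n`, the
coefficient vectors of `SmallCircuits ℂ n 5` hit every nonzero finite product `∏_j E_j` of polynomials
in the `N = C(2n,n)` coefficient variables with at most `N^a` monomials each.
[cite: ForbesShpilkaVolk2018, Cor. 34] -/
theorem isSuccinctHittingSet_sparseProducts_five :
    ∀ a : ℕ, ∃ n₀ : ℕ, ∀ n : ℕ, n₀ ≤ n →
      IsSuccinctHittingSet (degLEMonomials n) (SmallCircuits ℂ n 5)
        {D | ∃ (k : ℕ) (E : Fin k → MvPolynomial (degLEMonomials n) ℂ),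
          D = ∏ j, E j ∧ ∀ j, (E j).support.card ≤ Nat.choose (2 * n) n ^ a} := by
  intro a
  obtain ⟨n₀, h⟩ := exists_sparseGenerator_five a
  refine ⟨n₀, fun n hn => ?_⟩
  obtain ⟨t, Γ, hreal, hhit⟩ := h n hn
  rintro D ⟨k, E, rfl, hE⟩ hD0
  have hE0 : ∀ j, E j ≠ 0 := fun j h0 => hD0 (Finset.prod_eq_zero (Finset.mem_univ j) h0)
  exact exists_mem_smallCircuits_of_aeval_ne_zero hreal (aeval_generator_ne_zero_of_prod hhit hE0 hE)

/-- **No product of sparse polynomials is a natural proof against `SmallCircuits ℂ n b`, `b ≥ 5`**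
(tree: `not_isNaturalProof_prod_sparse`, `b ≥ 10`). [cite: ForbesShpilkaVolk2018, Def. 1 and Cor. 34] -/
theorem not_isNaturalProof_prod_sparse_five (a : ℕ) : ∃ n₀ : ℕ, ∀ n : ℕ, n₀ ≤ n → ∀ b : ℕ, 5 ≤ b →
    ∀ (𝒟 : Set (MvPolynomial (degLEMonomials n) ℂ)) (k : ℕ)
      (E : Fin k → MvPolynomial (degLEMonomials n) ℂ),
      (∀ j, (E j).support.card ≤ Nat.choose (2 * n) n ^ a) →
        ¬ IsNaturalProof (degLEMonomials n) (SmallCircuits ℂ n b) 𝒟 (∏ j, E j) := by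
  obtain ⟨n₀, h⟩ := isSuccinctHittingSet_sparseProducts_five a
  refine ⟨max n₀ 1, fun n hn b hb 𝒟 k E hE hnat => ?_⟩
  have hn₀ : n₀ ≤ n := le_trans (le_max_left _ _) hn
  have hn1 : 1 ≤ n := le_trans (le_max_right _ _) hn
  obtain ⟨f, hf, hne⟩ := h n hn₀ (∏ j, E j) ⟨k, E, rfl, hE⟩ hnat.2.1
  exact hne (hnat.2.2 f (smallCircuits_mono ℂ hb hn1 hf))

/-- **Level one reduces to the annihilators of the generator, at exponent 5** (tree:
`levelOne_of_generator_annihilators`, `max 10 b`): for `n ≥ n₀(1)`, with `Γ` the level-`1` generator of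
`exists_sparseGenerator_five`, if the level-one distinguishers ANNIHILATING `Γ` are hit by
`SmallCircuits ℂ n b`, then all level-one distinguishers are hit by `SmallCircuits ℂ n (max 5 b)`.
[cite: ForbesShpilkaVolk2018, §3 and Question 6] -/
theorem levelOne_of_generator_annihilators_five :
    ∃ n₀ : ℕ, ∀ n : ℕ, n₀ ≤ n →
      ∃ (t : ℕ) (Γ : degLEMonomials n → MvPolynomial (Fin t ⊕ (Fin t × Fin n)) ℂ),
        (∀ D : MvPolynomial (degLEMonomials n) ℂ, D ≠ 0 →
          D.support.card ≤ Nat.choose (2 * n) n → aeval Γ D ≠ 0) ∧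
        ∀ b : ℕ, IsSuccinctHittingSet (degLEMonomials n) (SmallCircuits ℂ n b)
            (Distinguishers ℂ n 1 ∩ {D | aeval Γ D = 0}) →
          IsSuccinctHittingSet (degLEMonomials n) (SmallCircuits ℂ n (max 5 b))
            (Distinguishers ℂ n 1) := by
  -- adapted from the tree's `levelOne_of_generator_annihilators` (exponent 10)
  obtain ⟨n₀, h⟩ := exists_sparseGenerator_five 1
  refine ⟨max n₀ 1, fun n hn => ?_⟩
  have hn₀ : n₀ ≤ n := le_trans (le_max_left _ _) hn
  have hn1 : 1 ≤ n := le_trans (le_max_right _ _) hn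
  obtain ⟨t, Γ, hreal, hhit⟩ := h n hn₀
  refine ⟨t, Γ, fun D hD0 hD => hhit D hD0 (by simpa only [pow_one] using hD), fun b hres => ?_⟩
  exact isSuccinctHittingSet_of_annihilators hn1 hreal hres

end Summit.ValiantsHypothesis.ValiantsHypothesis.Theorems.BarrierLever.SuccinctHittingSetsForVP

end
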